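/-
Copyright (c) 2026. All rights reserved.
Released under Apache 2.0 license as described in the file LICENSE.
-/
import Literature.MathematicalPhysics.QuantumLattice.HubbardPairCurrentTriplet
import Literature.MathematicalPhysics.QuantumLattice.PairCorrelations
import HarnessLib

/-!
# R2 rows (device D16): the benchmark singlet-pair correlator `P_g(x, y)` EQUALS one half of the
# sublattice-staggered bond-current correlator, exactly, in THE half-filled repulsive Hubbard ground
# state of the even square torus (`t' = 0`, `n = 1`; every `U > 0`, every form factor `g` with `g 0 = 0`)

HONEST FRAMING: ladder R1–R4 with certified numbers; no claim on H/H₀.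

Device D16 (Zhang's pseudospin triplet, `Literature/…/HubbardPairCurrentTriplet`, all PROVED there):
the singlet bond pair `d_{xy}`, its adjoint and the staggered bond current `ε_x j_{xy}` form a pseudospin
triplet, and THE half-filled ground state is a pseudospin singlet (Lieb 1989 + device D9), so for any two
weighted bond families joining opposite sublattices `⟨Δ_w ψ, Δ_{w'} ψ⟩ = ½ ⟨J_w ψ, J_{w'} ψ⟩`.
This file writes the identity in the CELL's vocabulary: Scalapino's local pair operator
`localPair g L x = Σ_{e} (g e/√2) d_{x, x+e}` of `Literature/…/PairCorrelations` (the object whose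
two-point function `pairFieldCorr g` and torus sum `dWaveOrderParamSq` are the R2/R3 observables of
`Targets.lean`) against the local STAGGERED CURRENT with the same form factor,
`localStaggeredCurrent g L x = Σ_{e ∈ {±e₁, ±e₂}} (g e/√2) ε_x j_{x, x+e}` (defined here; for
`g = d_{x²-y²}` this is the local `d`-density-wave / staggered-flux / orbital-antiferromagnet density of
Markiewicz–Vaughn, up to the conventional factor `i`):

* `hubbardTorus_localPairCorr_eq_half_localCurrentCorr` — `L` even, `t ≠ 0`, `U > 0`, `g 0 = 0`
  (`d_{x²-y²}`, extended `s`, `d_{xy}`-free nearest-neighbour factors), THE ground state `ψ` at `N = L²`: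
  `⟨ψ, P_g(x)† P_g(y) ψ⟩ = ½ ⟨ψ, J_g(x)† J_g(y) ψ⟩` for ALL `x, y` (equal sites, neighbours, any distance);
* `dWavePairCorr_four_eq_half_currentCorr` — the `4 × 4`, `t = 1` row for `g = dWaveFormFactor`
  (R2-TABLE §B, row B10), every `U > 0`;
* `extendedSWavePairCorr_four_eq_half_currentCorr` — the same for `g = extendedSWave`.

Consequences recorded in R2-TABLE / OBSERVABLES §5: at the particle–hole-symmetric corner the benchmark
`d`-wave pairing correlator `P_d(r)` (White et al. 1989; Moreo–Scalapino 1991; Scalapino 1995 §2) is NOT an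
independent observable — it is one half of the staggered `d`-current (DDW) correlator, distance by
distance, and the uniform `d`-wave pair structure factor is one half of the `(π, π)` `d`-current structure
factor. Every certified bracket on either side transports to the other with the factor `½` / `2`.

HONEST LIMITS: an exact IDENTITY, no number: it neither bounds `P_d(r)` nor decides its sign or decay;
half filling and `t' = 0` only (the `η`-`SU(2)` is exact there and broken at `t' ≠ 0` or `n ≠ 1`, where
only the Casimir INEQUALITY of `Theorems/SoloInformedPseudospinPairBound` survives); `g 0 = 0` is needed
(the on-site term of `localPair` is an `η`-pair, a pseudospin VECTOR component of a different triplet —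
device D10 treats it).

## References
* S.-C. Zhang, Phys. Rev. Lett. 65 (1990) 120. [cite: Zhang1990]
* C. N. Yang, S. C. Zhang, Mod. Phys. Lett. B 4 (1990) 759, Theorem 1. [cite: YangZhang1990, Theorem 1]
* R. S. Markiewicz, M. T. Vaughn, J. Phys. Chem. Solids 59 (1998) 1737, p. 3. [cite: MarkiewiczVaughn1998, p. 3]
* E. H. Lieb, Phys. Rev. Lett. 62 (1989) 1201, Theorem 2. [cite: LiebPRL1989, proof of Theorem 2]
* D. J. Scalapino, Phys. Rep. 250 (1995) 329, §2, eqs. (2.2)–(2.4). [cite: Scalapino1995, §2]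
-/

noncomputable section

namespace Summit.HubbardSuperconductivity.HubbardLadder

open Literature.MathematicalPhysics.QuantumLattice Literature.Probability.LatticeModels Matrix

variable {L : ℕ} [NeZero L]

/-! ### The local staggered current with form factor `g` -/

/-- The local STAGGERED bond current with form factor `g` at torus site `x`:
`J_g(x) = Σ_{e ∈ {±e₁, ±e₂}} (g e/√2) ε_x j_{x, x+e}`, `j_{xy} = Σ_σ (c†_{xσ} c_{yσ} - c†_{yσ} c_{xσ})`,
`ε_x = (-1)^{x₁+x₂}` — the partner of Scalapino's `localPair g L x` in Zhang's pseudospin triplet (for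
`g = d_{x²-y²}`: the local `d`-density-wave / orbital-antiferromagnet operator of Markiewicz–Vaughn, without
the factor `i`). -/
def localStaggeredCurrent (g : Site 2 → ℝ) (L : ℕ) [NeZero L] (x : TorusSite 2 L) :
    Matrix (Finset (Orb (FermionTorus 2 L))) (Finset (Orb (FermionTorus 2 L))) ℂ :=
  ∑ e ∈ unitSteps,
    (((g e / Real.sqrt 2 : ℝ) : ℂ) * ((torusStagger (FermionTorus.ofTorusSite x) : ℤ) : ℂ)) •
      bondCurrent (FermionTorus.ofTorusSite x) (FermionTorus.ofTorusSite (x + Torus.proj L e))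

/-- The origin is not one of the four unit steps (so `localPair` splits off its on-site term). -/
private theorem zero_not_mem_unitSteps' : (0 : Site 2) ∉ unitSteps := by
  simp only [unitSteps, Finset.mem_insert, Finset.mem_singleton]
  decide

/-- For a form factor vanishing at the origin, Scalapino's local pair operator is a weighted family of
singlet BOND pairs over the four unit steps: `P_g(x) = Σ_{e ∈ {±e₁, ±e₂}} (g e/√2) d_{x, x+e}`. -/
theorem localPair_eq_sum_unitSteps (g : Site 2 → ℝ) (hg : g 0 = 0) (x : TorusSite 2 L) :
    localPair g L x =
      ∑ e ∈ unitSteps, ((g e / Real.sqrt 2 : ℝ) : ℂ) •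
        bondPairAnn (FermionTorus.ofTorusSite x) (FermionTorus.ofTorusSite (x + Torus.proj L e)) := by
  rw [localPair, Finset.sum_insert zero_not_mem_unitSteps', hg, zero_div, Complex.ofReal_zero, zero_smul,
    zero_add]
  rfl

omit [NeZero L] in
/-- A unit step `e_i` is already reduced modulo `L`: `Torus.proj L e_i = e_i`. -/
private theorem torusProj_single' (i : Fin 2) : Torus.proj (d := 2) L (Pi.single i 1) = Pi.single i 1 := by
  funext j
  by_cases h : j = i
  · subst h; simp [Torus.proj]
  · simp [Torus.proj, h]

omit [NeZero L] in
/-- Likewise for the negative unit step: `Torus.proj L (-e_i) = -e_i`. -/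
private theorem torusProj_neg_single' (i : Fin 2) :
    Torus.proj (d := 2) L (-Pi.single i 1) = -Pi.single i 1 := by
  funext j
  by_cases h : j = i
  · subst h; simp [Torus.proj]
  · simp [Torus.proj, h]

/-- On the even torus a unit step flips the sublattice sign: `ε_{x+e} = -ε_x` for `e ∈ {±e₁, ±e₂}`. -/
private theorem torusStagger_add_unitStep (hL : Even L) (x : TorusSite 2 L) {e : Site 2} (he : e ∈ unitSteps) :
    torusStagger (FermionTorus.ofTorusSite (x + Torus.proj L e)) =
      -torusStagger (FermionTorus.ofTorusSite x) := by
  simp only [unitSteps, Finset.mem_insert, Finset.mem_singleton] at he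
  rcases he with rfl | rfl | rfl | rfl
  · exact torusStagger_eq_neg_of_toTorusSite_eq hL (i := 0)
      (by rw [FermionTorus.toTorusSite_ofTorusSite, FermionTorus.toTorusSite_ofTorusSite, torusProj_single'])
  · have h := torusStagger_eq_neg_of_toTorusSite_eq hL (i := 0)
      (x := FermionTorus.ofTorusSite (x + Torus.proj L (-Pi.single 0 1))) (y := FermionTorus.ofTorusSite x)
      (by rw [FermionTorus.toTorusSite_ofTorusSite, FermionTorus.toTorusSite_ofTorusSite,
        torusProj_neg_single', neg_add_cancel_right])
    rw [h, neg_neg]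
  · exact torusStagger_eq_neg_of_toTorusSite_eq hL (i := 1)
      (by rw [FermionTorus.toTorusSite_ofTorusSite, FermionTorus.toTorusSite_ofTorusSite, torusProj_single'])
  · have h := torusStagger_eq_neg_of_toTorusSite_eq hL (i := 1)
      (x := FermionTorus.ofTorusSite (x + Torus.proj L (-Pi.single 1 1))) (y := FermionTorus.ofTorusSite x)
      (by rw [FermionTorus.toTorusSite_ofTorusSite, FermionTorus.toTorusSite_ofTorusSite,
        torusProj_neg_single', neg_add_cancel_right])
    rw [h, neg_neg]

/-- `⟨ψ, A† B ψ⟩ = ⟨A ψ, B ψ⟩`. -/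
private theorem expect_conjTranspose_mul' {ι : Type*} [LinearOrder ι] [Fintype ι]
    (A B : Matrix (Finset ι) (Finset ι) ℂ) (ψ : Fock ι) :
    expect (Aᴴ * B) ψ = star (A *ᵥ ψ) ⬝ᵥ (B *ᵥ ψ) := by
  rw [expect, ← mulVec_mulVec, star_mulVec, ← dotProduct_mulVec]

/-! ### The rows -/

/-- **R2 row B10 (general even torus, every `U > 0`, every `t ≠ 0`, every form factor with `g 0 = 0`).**
In THE half-filled ground state `ψ` of the nearest-neighbour Hubbard model on `(ℤ/Lℤ)²`, `L` even,
the local singlet-pair two-point function equals one half of the local staggered-current two-point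
function with the same form factor, at EVERY pair of sites:
`⟨ψ, P_g(x)† P_g(y) ψ⟩ = ½ ⟨ψ, J_g(x)† J_g(y) ψ⟩`. Zhang (1990); Lieb (1989) Theorem 2. -/
theorem hubbardTorus_localPairCorr_eq_half_localCurrentCorr (hL : Even L) {t U : ℝ} (ht : t ≠ 0)
    (hU : 0 < U) {ψ : Fock (Orb (FermionTorus 2 L))}
    (hψ : IsGroundState (hamiltonian (fermionTorusGraph 2 L) t U) (L ^ 2) ψ)
    (g : Site 2 → ℝ) (hg : g 0 = 0) (x y : TorusSite 2 L) :
    expect ((localPair g L x)ᴴ * localPair g L y) ψ =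
      (1 / 2 : ℂ) * expect ((localStaggeredCurrent g L x)ᴴ * localStaggeredCurrent g L y) ψ := by
  rw [expect_conjTranspose_mul', expect_conjTranspose_mul', localPair_eq_sum_unitSteps g hg,
    localPair_eq_sum_unitSteps g hg, localStaggeredCurrent, localStaggeredCurrent]
  exact hubbardTorus_groundState_weightedPair_inner_eq_half hL ht hU hψ unitSteps
    (fun e => (FermionTorus.ofTorusSite x, FermionTorus.ofTorusSite (x + Torus.proj L e)))
    (fun e => ((g e / Real.sqrt 2 : ℝ) : ℂ)) (fun e he => torusStagger_add_unitStep hL x he) unitSteps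
    (fun e => (FermionTorus.ofTorusSite y, FermionTorus.ofTorusSite (y + Torus.proj L e)))
    (fun e => ((g e / Real.sqrt 2 : ℝ) : ℂ)) (fun e he => torusStagger_add_unitStep hL y he)

/-- **R2 row B10.d (`4 × 4`, `t = 1`, every `U > 0`)**: for THE half-filled ground state `ψ` of the `4 × 4`
Hubbard torus and Scalapino's `d_{x²-y²}` local pair operator,
`⟨ψ, P_d(x)† P_d(y) ψ⟩ = ½ ⟨ψ, J_d(x)† J_d(y) ψ⟩` at every pair of sites (`J_d` = local staggered
`d`-current = `d`-density-wave density). Zhang (1990); Lieb (1989). -/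
theorem dWavePairCorr_four_eq_half_currentCorr {U : ℝ} (hU : 0 < U) {ψ : Fock (Orb (FermionTorus 2 4))}
    (hψ : IsGroundState (hamiltonian (fermionTorusGraph 2 4) 1 U) 16 ψ) (x y : TorusSite 2 4) :
    expect ((localPair dWaveFormFactor 4 x)ᴴ * localPair dWaveFormFactor 4 y) ψ =
      (1 / 2 : ℂ) *
        expect ((localStaggeredCurrent dWaveFormFactor 4 x)ᴴ * localStaggeredCurrent dWaveFormFactor 4 y) ψ := by
  have hψ' : IsGroundState (hamiltonian (fermionTorusGraph 2 4) 1 U) (4 ^ 2) ψ := by simpa using hψ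
  exact hubbardTorus_localPairCorr_eq_half_localCurrentCorr (L := 4) (by decide) one_ne_zero hU hψ'
    dWaveFormFactor dWaveFormFactor_zero x y

/-- The extended-`s` form factor vanishes at the origin. -/
private theorem extendedSWave_zero : extendedSWave 0 = 0 := by
  rw [extendedSWave, if_neg zero_not_mem_unitSteps']

/-- **R2 row B10.xs (`4 × 4`, `t = 1`, every `U > 0`)**: the same identity for the extended-`s` local pair
operator. Zhang (1990); Lieb (1989). -/
theorem extendedSWavePairCorr_four_eq_half_currentCorr {U : ℝ} (hU : 0 < U)
    {ψ : Fock (Orb (FermionTorus 2 4))}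
    (hψ : IsGroundState (hamiltonian (fermionTorusGraph 2 4) 1 U) 16 ψ) (x y : TorusSite 2 4) :
    expect ((localPair extendedSWave 4 x)ᴴ * localPair extendedSWave 4 y) ψ =
      (1 / 2 : ℂ) *
        expect ((localStaggeredCurrent extendedSWave 4 x)ᴴ * localStaggeredCurrent extendedSWave 4 y) ψ := by
  have hψ' : IsGroundState (hamiltonian (fermionTorusGraph 2 4) 1 U) (4 ^ 2) ψ := by simpa using hψ
  exact hubbardTorus_localPairCorr_eq_half_localCurrentCorr (L := 4) (by decide) one_ne_zero hU hψ'
    extendedSWave extendedSWave_zero x y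

end Summit.HubbardSuperconductivity.HubbardLadder
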